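import Mathlib.Analysis.SpecialFunctions.Complex.Arctan
import Mathlib.Analysis.SpecialFunctions.Complex.Log
import Mathlib.Analysis.SpecialFunctions.Arsinh
import Mathlib.Analysis.SpecialFunctions.Trigonometric.Basic
import Mathlib.Analysis.Normed.Group.FunctionSeries
import Mathlib.Topology.Algebra.InfiniteSum.NatInt
import HarnessLib

/-!
# SHEET-ℝ frame: the engines' sine series `cos(θ/2)·gd⁻¹(θ/2) = 2Σ_{j≥1}(−1)^{j−1} sin jθ/(4j²−1)` and its tail

HONEST FRAMING (cell ns-blowup GROUP B / zone Z3, case Z3-SR-CERT; 1-D MODEL certificate frame; not Euler/NS).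

The interval stages of both SHEET-ℝ certificate implementations (cert-1 `SHEET-R-PRICE-impl1.md` §4 T1: «𝒰T₂ =
−(4L/π)Σ(−1)^{j−1} sin jθ/(4j²−1) — telescoping tail 1/(2K+1)»; cert-2 impl-2 plan: «Σ_{j>K}|u_j| = 2L/(π(2K+1)) exact») represent
the velocity of the far-field shape, `L²·𝒰T₂(L tan(θ/2)) = −(2L/π)·cos(θ/2)·arsinh(tan(θ/2))`
(`SheetRFarFieldT2.lineVelocity_farFieldT2_cayley`), by a sine series in the Cayley angle. This file PROVES that series and
its exact tail. For `θ ∈ (−π, π)` (so `gd⁻¹(θ/2) = arsinh(tan(θ/2))` is finite):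

  `cos(θ/2)·arsinh(tan(θ/2)) = Σ_{n≥0} (−1)ⁿ·2/((2n+1)(2n+3))·sin((n+1)θ)`  (`= 2Σ_{j≥1} (−1)^{j−1} sin(jθ)/(4j² − 1)`),
  `(π/2)·cos(θ/2) − 1     = Σ_{n≥0} (−1)ⁿ·2/((2n+1)(2n+3))·cos((n+1)θ)`  (the cosine companion, Fourier series of `|cos(θ/2)|`),

both ABSOLUTELY convergent, `Σ_{n≥K} 2/((2n+1)(2n+3)) = 1/(2K+1)` (telescoping) ⇒ uniform truncation error `≤ 1/(2K+1)` after `K`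
terms (§5). PROOF (no Fourier analysis): on the open unit disc the arctangent power series
(`Complex.hasSum_arctan`) gives `(w + w⁻¹)·arctan w − 1 = Σ_{n≥0} (−1)ⁿ·2/((2n+1)(2n+3))·w^{2n+2}` (§1); the right-hand side is
continuous on the CLOSED disc (Weierstrass M-test, `continuousOn_tsum`), the left-hand side is continuous at every boundary point
`w₀ = e^{iφ}`, `|φ| < π/2` (there `(1 + iw₀)/(1 − iw₀) = i·cos φ/(1 + sin φ)` lies on the positive imaginary axis, inside the slit
plane), so the identity extends to `w₀` by approach along the radius (§2); and `arctan(e^{iφ}) = π/4 + (i/2)·arsinh(tan φ)`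
(`log(i q) = log q + iπ/2`, `1/q = (1 + sin φ)/cos φ = tan φ + sec φ`, §3). Real and imaginary parts at `w₀ = e^{iθ/2}` give the
two series (§4). Classical (conjugate pair of the `|cos(θ/2)|` series; background only — everything here is proved). Pure analysis
about explicit functions; no definition, no named fact, nothing asserted about any profile. MODEL frame bookkeeping only.
-/

noncomputable section

namespace Summit.NavierStokesRegularity.OSWSelfSimilar
namespace SheetRGudermannianSeries

open _root_.Complex _root_.Filter _root_.Metric _root_.Set _root_.Finset
open scoped Real Topology

/-! ### §0 The coefficients: telescoping tail and summability -/

/-- Telescoping: `Σ_{n≥0} 2/((2(n+K)+1)(2(n+K)+3)) = 1/(2K+1)`. [folklore] -/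
theorem hasSum_two_div_odd_mul_odd_tail (K : ℕ) :
    HasSum (fun n : ℕ => (2 : ℝ) / ((2 * (n + K : ℝ) + 1) * (2 * (n + K : ℝ) + 3))) (1 / (2 * K + 1)) := by
  have hnonneg : ∀ n : ℕ, (0 : ℝ) ≤ 2 / ((2 * (n + K : ℝ) + 1) * (2 * (n + K : ℝ) + 3)) := fun n => by positivity
  rw [hasSum_iff_tendsto_nat_of_nonneg hnonneg]
  -- partial sums: `Σ_{i<n} = 1/(2K+1) − 1/(2(n+K)+1)`
  have hpartial : ∀ n : ℕ, ∑ i ∈ range n, (2 : ℝ) / ((2 * (i + K : ℝ) + 1) * (2 * (i + K : ℝ) + 3)) =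
      1 / (2 * K + 1) - 1 / (2 * (n + K : ℝ) + 1) := by
    intro n
    induction n with
    | zero => simp
    | succ n ih =>
      rw [sum_range_succ, ih]
      have h1 : (2 * (n + K : ℝ) + 1) ≠ 0 := by positivity
      have h2 : (2 * (n + K : ℝ) + 3) ≠ 0 := by positivity
      have h3 : (2 * ((n + 1 : ℕ) + K : ℝ) + 1) ≠ 0 := by positivity
      push_cast
      field_simp
      ring
  simp_rw [hpartial]
  have hlim : Tendsto (fun n : ℕ => 1 / (2 * (n + K : ℝ) + 1)) atTop (𝓝 0) := by
    have h1 : Tendsto (fun n : ℕ => 2 * (n + K : ℝ) + 1) atTop atTop := by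
      refine tendsto_atTop_add_const_right _ _ (Tendsto.const_mul_atTop two_pos ?_)
      exact tendsto_atTop_add_const_right _ _ tendsto_natCast_atTop_atTop
    refine (h1.inv_tendsto_atTop).congr fun n => ?_
    simp only [Pi.inv_apply, one_div]
  simpa using (tendsto_const_nhds (x := (1 : ℝ) / (2 * K + 1))).sub hlim

/-- `Σ_{n≥0} 2/((2n+1)(2n+3)) = 1`. [folklore] -/
theorem hasSum_two_div_odd_mul_odd :
    HasSum (fun n : ℕ => (2 : ℝ) / ((2 * n + 1) * (2 * n + 3))) 1 := by
  simpa using hasSum_two_div_odd_mul_odd_tail 0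

/-- The coefficient sequence `(−1)ⁿ·2/((2n+1)(2n+3))` is absolutely summable, with `Σ |·| = 1`. [folklore] -/
theorem summable_abs_coeff :
    Summable (fun n : ℕ => |(-1 : ℝ) ^ n * 2 / ((2 * n + 1) * (2 * n + 3))|) := by
  refine hasSum_two_div_odd_mul_odd.summable.congr fun n => ?_
  rw [abs_div, abs_mul, abs_pow, abs_neg, abs_one, one_pow, one_mul, abs_of_pos (by norm_num : (0:ℝ) < 2),
    abs_of_pos (by positivity)]

/-- The tail of the absolute values: `Σ_{n≥K} 2/((2n+1)(2n+3)) = 1/(2K+1)`. [folklore] -/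
theorem tsum_abs_coeff_tail (K : ℕ) :
    ∑' n : ℕ, |(-1 : ℝ) ^ (n + K) * 2 / ((2 * (n + K : ℕ) + 1) * (2 * (n + K : ℕ) + 3))| = 1 / (2 * K + 1) := by
  rw [← (hasSum_two_div_odd_mul_odd_tail K).tsum_eq]
  refine tsum_congr fun n => ?_
  push_cast
  rw [abs_div, abs_mul, abs_pow, abs_neg, abs_one, one_pow, one_mul, abs_of_pos (by norm_num : (0:ℝ) < 2),
    abs_of_pos (by positivity)]

/-! ### §1 The generating identity on the open unit disc -/

/-- On the open unit disc, away from the origin: `Σ_{n≥0} (−1)ⁿ·2/((2n+1)(2n+3))·w^{2n+2} = (w + w⁻¹)·arctan w − 1`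
(from the power series of `arctan`). [folklore] -/
theorem hasSum_coeff_mul_pow_of_norm_lt_one {w : ℂ} (hw : ‖w‖ < 1) (hw0 : w ≠ 0) :
    HasSum (fun n : ℕ => (((-1 : ℝ) ^ n * 2 / ((2 * n + 1) * (2 * n + 3)) : ℝ) : ℂ) * w ^ (2 * n + 2))
      ((w + w⁻¹) * Complex.arctan w - 1) := by
  have h := Complex.hasSum_arctan hw
  have h1 := h.mul_left w
  have h2 := (hasSum_nat_add_iff' 1).mpr (h.mul_left w⁻¹)
  simp only [sum_range_one, pow_zero, one_mul, mul_zero, zero_add, pow_one, Nat.cast_one, div_one,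
    inv_mul_cancel₀ hw0] at h2
  have hsum := h1.add h2
  have hfun : (fun n : ℕ => (((-1 : ℝ) ^ n * 2 / ((2 * n + 1) * (2 * n + 3)) : ℝ) : ℂ) * w ^ (2 * n + 2)) =
      fun n : ℕ => w * ((-1) ^ n * w ^ (2 * n + 1) / ((2 * n + 1 : ℕ) : ℂ)) +
        w⁻¹ * ((-1) ^ (n + 1) * w ^ (2 * (n + 1) + 1) / ((2 * (n + 1) + 1 : ℕ) : ℂ)) := by
    funext n
    have hc1 : ((2 * n + 1 : ℕ) : ℂ) = 2 * (n : ℂ) + 1 := by push_cast; ring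
    have hc2 : ((2 * (n + 1) + 1 : ℕ) : ℂ) = 2 * (n : ℂ) + 3 := by push_cast; ring
    have ha : (2 * (n : ℂ) + 1) ≠ 0 := by norm_cast
    have hb : (2 * (n : ℂ) + 3) ≠ 0 := by norm_cast
    rw [hc1, hc2]
    push_cast
    field_simp
    ring
  have hval : w * Complex.arctan w + (w⁻¹ * Complex.arctan w - 1) = (w + w⁻¹) * Complex.arctan w - 1 := by ring
  rw [hfun, ← hval]
  exact hsum

/-! ### §2 Extension to the unit circle by radial approach -/

/-- Termwise bound on the closed unit disc: `‖a_n w^{2n+2}‖ ≤ |a_n|` for `‖w‖ ≤ 1`. [folklore] -/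
theorem norm_coeff_mul_pow_le {w : ℂ} (hw : ‖w‖ ≤ 1) (n : ℕ) :
    ‖(((-1 : ℝ) ^ n * 2 / ((2 * n + 1) * (2 * n + 3)) : ℝ) : ℂ) * w ^ (2 * n + 2)‖ ≤
      |(-1 : ℝ) ^ n * 2 / ((2 * n + 1) * (2 * n + 3))| := by
  rw [norm_mul, Complex.norm_real, Real.norm_eq_abs, norm_pow]
  have h1 : ‖w‖ ^ (2 * n + 2) ≤ 1 := pow_le_one₀ (norm_nonneg _) hw
  calc |(-1 : ℝ) ^ n * 2 / ((2 * n + 1) * (2 * n + 3))| * ‖w‖ ^ (2 * n + 2)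
      ≤ |(-1 : ℝ) ^ n * 2 / ((2 * n + 1) * (2 * n + 3))| * 1 := mul_le_mul_of_nonneg_left h1 (abs_nonneg _)
    _ = _ := mul_one _

/-- The series is (absolutely) summable at every point of the closed unit disc. [folklore] -/
theorem summable_coeff_mul_pow {w : ℂ} (hw : ‖w‖ ≤ 1) :
    Summable (fun n : ℕ => (((-1 : ℝ) ^ n * 2 / ((2 * n + 1) * (2 * n + 3)) : ℝ) : ℂ) * w ^ (2 * n + 2)) :=
  summable_abs_coeff.of_norm_bounded (norm_coeff_mul_pow_le hw)

/-- The sum is continuous on the closed unit disc (Weierstrass M-test). [folklore] -/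
theorem continuousOn_tsum_coeff_mul_pow :
    ContinuousOn (fun w : ℂ => ∑' n : ℕ, (((-1 : ℝ) ^ n * 2 / ((2 * n + 1) * (2 * n + 3)) : ℝ) : ℂ) * w ^ (2 * n + 2))
      (closedBall (0 : ℂ) 1) := by
  refine continuousOn_tsum (fun n => ?_) summable_abs_coeff (fun n w hw => ?_)
  · exact (continuous_const.mul (continuous_pow (2 * n + 2))).continuousOn
  · exact norm_coeff_mul_pow_le (mem_closedBall_zero_iff.mp hw) n

/-- `Complex.arctan` is continuous at every `z` with `1 − z·I ≠ 0` and `(1 + z·I)/(1 − z·I)` in the slit plane. [folklore] -/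
theorem continuousAt_complex_arctan {z : ℂ} (h1 : 1 - z * I ≠ 0) (h2 : (1 + z * I) / (1 - z * I) ∈ slitPlane) :
    ContinuousAt Complex.arctan z := by
  have hq : ContinuousAt (fun z : ℂ => (1 + z * I) / (1 - z * I)) z :=
    ContinuousAt.div (by fun_prop) (by fun_prop) h1
  exact continuousAt_const.mul
    (ContinuousAt.comp (g := Complex.log) (f := fun z : ℂ => (1 + z * I) / (1 - z * I)) (continuousAt_clog h2) hq)

/-- **The generating identity ON the unit circle**: for `‖w₀‖ = 1` with `1 − w₀I ≠ 0` and `(1 + w₀I)/(1 − w₀I)` in the slit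
plane (i.e. `w₀ ≠ ±i`), `Σ_{n≥0} (−1)ⁿ·2/((2n+1)(2n+3))·w₀^{2n+2} = (w₀ + w₀⁻¹)·arctan w₀ − 1` (both sides are limits along the
radius `r·w₀`, `r → 1⁻`). [folklore] -/
theorem tsum_coeff_mul_pow_of_norm_eq_one {w₀ : ℂ} (hw₀ : ‖w₀‖ = 1) (h1 : 1 - w₀ * I ≠ 0)
    (h2 : (1 + w₀ * I) / (1 - w₀ * I) ∈ slitPlane) :
    ∑' n : ℕ, (((-1 : ℝ) ^ n * 2 / ((2 * n + 1) * (2 * n + 3)) : ℝ) : ℂ) * w₀ ^ (2 * n + 2) =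
      (w₀ + w₀⁻¹) * Complex.arctan w₀ - 1 := by
  set T : ℂ → ℂ := fun w => ∑' n : ℕ, (((-1 : ℝ) ^ n * 2 / ((2 * n + 1) * (2 * n + 3)) : ℝ) : ℂ) * w ^ (2 * n + 2)
    with hT
  set R : ℂ → ℂ := fun w => (w + w⁻¹) * Complex.arctan w - 1 with hR
  have hw₀0 : w₀ ≠ 0 := by
    intro h; rw [h, norm_zero] at hw₀; exact zero_ne_one hw₀
  -- the radial path `γ r = r·w₀`
  set γ : ℝ → ℂ := fun r => (r : ℂ) * w₀ with hγ
  have hγ_cont : Continuous γ := Complex.continuous_ofReal.mul continuous_const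
  have hγ1 : γ 1 = w₀ := by simp [hγ]
  have hγ_nhds : Tendsto γ (𝓝[<] (1:ℝ)) (𝓝 w₀) := by
    rw [← hγ1]; exact (hγ_cont.tendsto 1).mono_left nhdsWithin_le_nhds
  -- `T ∘ γ → T w₀`
  have hTlim : Tendsto (fun r => T (γ r)) (𝓝[<] (1:ℝ)) (𝓝 (T w₀)) := by
    have hcw : ContinuousWithinAt T (closedBall 0 1) w₀ :=
      continuousOn_tsum_coeff_mul_pow w₀ (mem_closedBall_zero_iff.mpr hw₀.le)
    have hγlim : Tendsto γ (𝓝[<] (1:ℝ)) (𝓝[closedBall 0 1] w₀) := by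
      refine tendsto_nhdsWithin_iff.mpr ⟨hγ_nhds, ?_⟩
      filter_upwards [Ioo_mem_nhdsLT zero_lt_one] with r hr
      rw [mem_closedBall_zero_iff, hγ]
      simp only [norm_mul, Complex.norm_real, Real.norm_eq_abs, hw₀, mul_one]
      rw [abs_of_pos hr.1]
      exact hr.2.le
    exact hcw.tendsto.comp hγlim
  -- `R ∘ γ → R w₀`
  have hRlim : Tendsto (fun r => R (γ r)) (𝓝[<] (1:ℝ)) (𝓝 (R w₀)) := by
    have hRc : ContinuousAt R w₀ := by
      have ha := continuousAt_complex_arctan h1 h2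
      have hb : ContinuousAt (fun w : ℂ => w + w⁻¹) w₀ := continuousAt_id.add (continuousAt_inv₀ hw₀0)
      exact (hb.mul ha).sub continuousAt_const
    exact hRc.tendsto.comp hγ_nhds
  -- the two agree on `r ∈ (0, 1)`
  have heq : (fun r => T (γ r)) =ᶠ[𝓝[<] (1:ℝ)] fun r => R (γ r) := by
    filter_upwards [Ioo_mem_nhdsLT zero_lt_one] with r hr
    have hnorm : ‖γ r‖ < 1 := by
      rw [hγ]
      simp only [norm_mul, Complex.norm_real, Real.norm_eq_abs, hw₀, mul_one]
      rw [abs_of_pos hr.1]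
      exact hr.2
    have hne : γ r ≠ 0 := mul_ne_zero (by exact_mod_cast hr.1.ne') hw₀0
    exact (hasSum_coeff_mul_pow_of_norm_lt_one hnorm hne).tsum_eq
  exact tendsto_nhds_unique (hTlim.congr' heq) hRlim

/-! ### §3 The arctangent of a unimodular number: `arctan(e^{iφ}) = π/4 + (i/2)·arsinh(tan φ)` -/

/-- `e^{iφ} = cos φ + i sin φ` with real parts displayed. [folklore] -/
theorem exp_ofReal_mul_I_eq (φ : ℝ) :
    Complex.exp ((φ : ℂ) * I) = ((Real.cos φ : ℝ) : ℂ) + ((Real.sin φ : ℝ) : ℂ) * I := by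
  rw [Complex.exp_mul_I, ← Complex.ofReal_cos, ← Complex.ofReal_sin]

/-- For `|φ| < π/2`: `1 + sin φ > 0`. [folklore] -/
theorem one_add_sin_pos {φ : ℝ} (hφ : φ ∈ Ioo (-(π / 2)) (π / 2)) : 0 < 1 + Real.sin φ := by
  have hc : 0 < Real.cos φ := Real.cos_pos_of_mem_Ioo hφ
  nlinarith [Real.neg_one_le_sin φ, sq_nonneg (1 + Real.sin φ), Real.sin_sq_add_cos_sq φ]

/-- For `|φ| < π/2`: `1 − e^{iφ}·i ≠ 0` (its real part is `1 + sin φ > 0`). [folklore] -/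
theorem one_sub_exp_mul_I_mul_I_ne_zero {φ : ℝ} (hφ : φ ∈ Ioo (-(π / 2)) (π / 2)) :
    1 - Complex.exp ((φ : ℂ) * I) * I ≠ 0 := by
  intro h
  have hre := congrArg Complex.re h
  rw [exp_ofReal_mul_I_eq] at hre
  simp only [Complex.sub_re, Complex.one_re, Complex.mul_re, Complex.add_re, Complex.ofReal_re, Complex.mul_im,
    Complex.ofReal_im, Complex.I_re, Complex.I_im, Complex.add_im, Complex.zero_re, mul_zero, mul_one, zero_add,
    sub_zero, add_zero] at hre
  have := one_add_sin_pos hφ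
  linarith

/-- For `|φ| < π/2`: `(1 + e^{iφ}i)/(1 − e^{iφ}i) = i·cos φ/(1 + sin φ)` — a point of the positive imaginary axis. [folklore] -/
theorem one_add_exp_mul_I_div {φ : ℝ} (hφ : φ ∈ Ioo (-(π / 2)) (π / 2)) :
    (1 + Complex.exp ((φ : ℂ) * I) * I) / (1 - Complex.exp ((φ : ℂ) * I) * I) =
      ((Real.cos φ / (1 + Real.sin φ) : ℝ) : ℂ) * I := by
  have hden := one_sub_exp_mul_I_mul_I_ne_zero hφ
  have hs : (1 + Real.sin φ) ≠ 0 := (one_add_sin_pos hφ).ne'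
  have hpy := Real.sin_sq_add_cos_sq φ
  rw [div_eq_iff hden, exp_ofReal_mul_I_eq]
  apply Complex.ext
  · simp only [Complex.add_re, Complex.one_re, Complex.mul_re, Complex.mul_im, Complex.ofReal_re, Complex.ofReal_im,
      Complex.I_re, Complex.I_im, Complex.sub_re, Complex.sub_im, Complex.add_im, Complex.one_im]
    field_simp
    nlinarith [hpy]
  · simp only [Complex.add_im, Complex.one_im, Complex.mul_re, Complex.mul_im, Complex.ofReal_re, Complex.ofReal_im,
      Complex.I_re, Complex.I_im, Complex.sub_re, Complex.sub_im, Complex.add_re, Complex.one_re]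
    field_simp
    ring

/-- `i·q` lies in the slit plane for real `q ≠ 0`. [folklore] -/
theorem ofReal_mul_I_mem_slitPlane {q : ℝ} (hq : q ≠ 0) : ((q : ℝ) : ℂ) * I ∈ slitPlane := by
  rw [mem_slitPlane_iff]
  right
  simpa using hq

/-- `log(i·q) = log q + iπ/2` for `q > 0`. [folklore] -/
theorem log_ofReal_mul_I {q : ℝ} (hq : 0 < q) :
    Complex.log (((q : ℝ) : ℂ) * I) = ((Real.log q : ℝ) : ℂ) + (π / 2 : ℝ) * I := by
  apply Complex.ext
  · rw [Complex.log_re]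
    simp [abs_of_pos hq]
  · rw [Complex.log_im, Complex.arg_real_mul I hq, Complex.arg_I]
    simp

/-- `arsinh(tan φ) = log((1 + sin φ)/cos φ)` for `|φ| < π/2` (`√(1 + tan²φ) = 1/cos φ`). [folklore] -/
theorem arsinh_tan_eq_log {φ : ℝ} (hφ : φ ∈ Ioo (-(π / 2)) (π / 2)) :
    Real.arsinh (Real.tan φ) = Real.log ((1 + Real.sin φ) / Real.cos φ) := by
  have hc : 0 < Real.cos φ := Real.cos_pos_of_mem_Ioo hφ
  rw [Real.arsinh]
  congr 1
  have h1 : √(1 + Real.tan φ ^ 2) = (Real.cos φ)⁻¹ := by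
    rw [← Real.inv_sqrt_one_add_tan_sq hc, inv_inv]
  rw [h1, Real.tan_eq_sin_div_cos]
  field_simp
  ring

/-- **`arctan(e^{iφ}) = π/4 + (i/2)·arsinh(tan φ)`** for `|φ| < π/2` (`arsinh ∘ tan = gd⁻¹`, the inverse Gudermannian).
[folklore] -/
theorem arctan_exp_mul_I {φ : ℝ} (hφ : φ ∈ Ioo (-(π / 2)) (π / 2)) :
    Complex.arctan (Complex.exp ((φ : ℂ) * I)) =
      (π / 4 : ℝ) + ((Real.arsinh (Real.tan φ) / 2 : ℝ) : ℂ) * I := by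
  have hc : 0 < Real.cos φ := Real.cos_pos_of_mem_Ioo hφ
  have hs : 0 < 1 + Real.sin φ := one_add_sin_pos hφ
  have hq : 0 < Real.cos φ / (1 + Real.sin φ) := div_pos hc hs
  rw [Complex.arctan, one_add_exp_mul_I_div hφ, log_ofReal_mul_I hq, arsinh_tan_eq_log hφ,
    show (1 + Real.sin φ) / Real.cos φ = (Real.cos φ / (1 + Real.sin φ))⁻¹ by rw [inv_div], Real.log_inv]
  push_cast
  ring_nf
  rw [Complex.I_sq]
  ring

/-! ### §4 The two real series on `(−π, π)` -/

/-- `(2n+1)(2n+3) = 4(n+1)² − 1`: the coefficients are `(−1)^{j−1}·2/(4j² − 1)` at `j = n + 1`. [folklore] -/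
theorem coeff_eq_sq_form (n : ℕ) :
    ((-1 : ℝ) ^ n * 2 / ((2 * n + 1) * (2 * n + 3))) = (-1 : ℝ) ^ n * 2 / (4 * ((n : ℝ) + 1) ^ 2 - 1) := by
  congr 1; ring

/-- At `w₀ = e^{iθ/2}`: the complex series sums to `2cos(θ/2)·arctan(e^{iθ/2}) − 1
= (π/2)cos(θ/2) − 1 + i·cos(θ/2)·arsinh(tan(θ/2))`. [folklore] -/
theorem hasSum_coeff_mul_exp_half {θ : ℝ} (hθ : θ ∈ Ioo (-π) π) :
    HasSum (fun n : ℕ => (((-1 : ℝ) ^ n * 2 / ((2 * n + 1) * (2 * n + 3)) : ℝ) : ℂ) *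
        Complex.exp (((θ / 2 : ℝ) : ℂ) * I) ^ (2 * n + 2))
      (((π / 2 * Real.cos (θ / 2) - 1 : ℝ) : ℂ) +
        ((Real.cos (θ / 2) * Real.arsinh (Real.tan (θ / 2)) : ℝ) : ℂ) * I) := by
  have hφ : θ / 2 ∈ Ioo (-(π / 2)) (π / 2) := by
    constructor <;> linarith [hθ.1, hθ.2]
  set w₀ : ℂ := Complex.exp (((θ / 2 : ℝ) : ℂ) * I) with hw₀
  have hnorm : ‖w₀‖ = 1 := by rw [hw₀, Complex.norm_exp_ofReal_mul_I]
  have h1 := one_sub_exp_mul_I_mul_I_ne_zero hφ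
  have h2 : (1 + w₀ * I) / (1 - w₀ * I) ∈ slitPlane := by
    rw [hw₀, one_add_exp_mul_I_div hφ]
    exact ofReal_mul_I_mem_slitPlane (div_pos (Real.cos_pos_of_mem_Ioo hφ) (one_add_sin_pos hφ)).ne'
  have hsum := (summable_coeff_mul_pow hnorm.le).hasSum
  rw [tsum_coeff_mul_pow_of_norm_eq_one hnorm h1 h2] at hsum
  -- evaluate the closed form
  have hinv : w₀⁻¹ = Complex.exp (-(((θ / 2 : ℝ) : ℂ) * I)) := by rw [hw₀, Complex.exp_neg]
  have hcos : w₀ + w₀⁻¹ = 2 * ((Real.cos (θ / 2) : ℝ) : ℂ) := by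
    rw [hinv, hw₀, Complex.ofReal_cos, Complex.cos, neg_mul]
    ring
  rw [hcos, hw₀, arctan_exp_mul_I hφ] at hsum
  convert hsum using 1
  push_cast
  ring

/-- **The sine series of `cos(θ/2)·gd⁻¹(θ/2)`**: for `θ ∈ (−π, π)`,
`cos(θ/2)·arsinh(tan(θ/2)) = Σ_{n≥0} (−1)ⁿ·2/((2n+1)(2n+3))·sin((n+1)θ)` (`= 2Σ_{j≥1}(−1)^{j−1} sin jθ/(4j²−1)`). [folklore] -/
theorem hasSum_sin_series_cos_half_mul_arsinh_tan_half {θ : ℝ} (hθ : θ ∈ Ioo (-π) π) :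
    HasSum (fun n : ℕ => (-1 : ℝ) ^ n * 2 / ((2 * n + 1) * (2 * n + 3)) * Real.sin ((n + 1) * θ))
      (Real.cos (θ / 2) * Real.arsinh (Real.tan (θ / 2))) := by
  have h := Complex.hasSum_im (hasSum_coeff_mul_exp_half hθ)
  simp only [Complex.add_im, Complex.ofReal_im, Complex.mul_im, Complex.ofReal_re, Complex.I_re, Complex.I_im,
    mul_zero, mul_one, zero_add, add_zero] at h
  refine h.congr_fun fun n => ?_
  rw [← Complex.exp_nat_mul]
  have : ((2 * n + 2 : ℕ) : ℂ) * (((θ / 2 : ℝ) : ℂ) * I) = (((n + 1) * θ : ℝ) : ℂ) * I := by push_cast; ring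
  rw [this, Complex.exp_ofReal_mul_I_im, Complex.exp_ofReal_mul_I_re]
  ring

/-- **The cosine series of `(π/2)cos(θ/2) − 1`** (the Fourier series of `|cos(θ/2)|`): for `θ ∈ (−π, π)`,
`(π/2)·cos(θ/2) − 1 = Σ_{n≥0} (−1)ⁿ·2/((2n+1)(2n+3))·cos((n+1)θ)`. [folklore] -/
theorem hasSum_cos_series_cos_half {θ : ℝ} (hθ : θ ∈ Ioo (-π) π) :
    HasSum (fun n : ℕ => (-1 : ℝ) ^ n * 2 / ((2 * n + 1) * (2 * n + 3)) * Real.cos ((n + 1) * θ))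
      (π / 2 * Real.cos (θ / 2) - 1) := by
  have h := Complex.hasSum_re (hasSum_coeff_mul_exp_half hθ)
  simp only [Complex.add_re, Complex.ofReal_re, Complex.mul_re, Complex.ofReal_im, Complex.I_re, Complex.I_im,
    mul_zero, mul_one, sub_zero, add_zero, zero_mul, sub_self] at h
  refine h.congr_fun fun n => ?_
  rw [← Complex.exp_nat_mul]
  have : ((2 * n + 2 : ℕ) : ℂ) * (((θ / 2 : ℝ) : ℂ) * I) = (((n + 1) * θ : ℝ) : ℂ) * I := by push_cast; ring
  rw [this, Complex.exp_ofReal_mul_I_re]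

/-! ### §5 Truncation after `K` terms: uniform error `≤ 1/(2K+1)` -/

/-- **Truncation error of the sine series**: for `θ ∈ (−π, π)` and every `K`,
`|cos(θ/2)·arsinh(tan(θ/2)) − Σ_{n<K} (−1)ⁿ·2/((2n+1)(2n+3))·sin((n+1)θ)| ≤ 1/(2K+1)` (the telescoping tail
`Σ_{n≥K} 2/((2n+1)(2n+3)) = 1/(2K+1)`). [folklore] -/
theorem abs_cos_half_mul_arsinh_tan_half_sub_sum_le {θ : ℝ} (hθ : θ ∈ Ioo (-π) π) (K : ℕ) :
    |Real.cos (θ / 2) * Real.arsinh (Real.tan (θ / 2)) -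
        ∑ n ∈ range K, (-1 : ℝ) ^ n * 2 / ((2 * n + 1) * (2 * n + 3)) * Real.sin ((n + 1) * θ)| ≤
      1 / (2 * K + 1) := by
  have hG := hasSum_sin_series_cos_half_mul_arsinh_tan_half hθ
  have htail := (hasSum_nat_add_iff' K).mpr hG
  have hbound := hasSum_two_div_odd_mul_odd_tail K
  rw [← Real.norm_eq_abs]
  refine htail.norm_le_of_bounded hbound fun n => ?_
  rw [Real.norm_eq_abs, abs_mul, abs_div, abs_mul, abs_pow, abs_neg, abs_one, one_pow, one_mul,
    abs_of_pos (by norm_num : (0:ℝ) < 2)]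
  have hs : |Real.sin ((((n + K : ℕ) : ℝ) + 1) * θ)| ≤ 1 := Real.abs_sin_le_one _
  have hd : (0:ℝ) < (2 * ((n + K : ℕ) : ℝ) + 1) * (2 * ((n + K : ℕ) : ℝ) + 3) := by positivity
  rw [abs_of_pos hd]
  push_cast
  calc 2 / ((2 * ((n : ℝ) + K) + 1) * (2 * ((n : ℝ) + K) + 3)) * |Real.sin (((n : ℝ) + K + 1) * θ)|
      ≤ 2 / ((2 * ((n : ℝ) + K) + 1) * (2 * ((n : ℝ) + K) + 3)) * 1 :=
        mul_le_mul_of_nonneg_left (by simpa using hs) (by positivity)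
    _ = 2 / ((2 * ((n : ℝ) + K) + 1) * (2 * ((n : ℝ) + K) + 3)) := mul_one _

/-- **Truncation error of the cosine series**: for `θ ∈ (−π, π)` and every `K`,
`|(π/2)cos(θ/2) − 1 − Σ_{n<K} (−1)ⁿ·2/((2n+1)(2n+3))·cos((n+1)θ)| ≤ 1/(2K+1)`. [folklore] -/
theorem abs_cos_half_sub_sum_le {θ : ℝ} (hθ : θ ∈ Ioo (-π) π) (K : ℕ) :
    |π / 2 * Real.cos (θ / 2) - 1 -
        ∑ n ∈ range K, (-1 : ℝ) ^ n * 2 / ((2 * n + 1) * (2 * n + 3)) * Real.cos ((n + 1) * θ)| ≤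
      1 / (2 * K + 1) := by
  have hG := hasSum_cos_series_cos_half hθ
  have htail := (hasSum_nat_add_iff' K).mpr hG
  have hbound := hasSum_two_div_odd_mul_odd_tail K
  rw [← Real.norm_eq_abs]
  refine htail.norm_le_of_bounded hbound fun n => ?_
  rw [Real.norm_eq_abs, abs_mul, abs_div, abs_mul, abs_pow, abs_neg, abs_one, one_pow, one_mul,
    abs_of_pos (by norm_num : (0:ℝ) < 2)]
  have hs : |Real.cos ((((n + K : ℕ) : ℝ) + 1) * θ)| ≤ 1 := Real.abs_cos_le_one _
  have hd : (0:ℝ) < (2 * ((n + K : ℕ) : ℝ) + 1) * (2 * ((n + K : ℕ) : ℝ) + 3) := by positivity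
  rw [abs_of_pos hd]
  push_cast
  calc 2 / ((2 * ((n : ℝ) + K) + 1) * (2 * ((n : ℝ) + K) + 3)) * |Real.cos (((n : ℝ) + K + 1) * θ)|
      ≤ 2 / ((2 * ((n : ℝ) + K) + 1) * (2 * ((n : ℝ) + K) + 3)) * 1 :=
        mul_le_mul_of_nonneg_left (by simpa using hs) (by positivity)
    _ = 2 / ((2 * ((n : ℝ) + K) + 1) * (2 * ((n : ℝ) + K) + 3)) := mul_one _

end SheetRGudermannianSeries
end Summit.NavierStokesRegularity.OSWSelfSimilar
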